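import Summits.Ventures.PercRepro.C025ProfilePLDCertificate
import Summits.Ventures.PercRepro.C025ProfilePLDResidual

/-!
# THE RESIDUAL CERTIFICATE LEMMA: CERTIFICATES IN THE RESIDUAL INSTANCES (PLD_hi) LIFT TO INEQUALITIES ON THE MATROID (night-3 g36)

`proofs/NIGHT3-G36-CEILING.md` §3.  The RESIDUAL FORM of per-layer dominance (NIGHT3-G27-PLD.md §2, NIGHT3-G28-PAVING.md §1) at
`(lo, hi, δ)` is the inequality `#RS ≤ #THI` between the residual sources — `lo ≤ ρ(I) ≤ hi`, `ρ(E∖I) ≥ hi + δ + 1`, weight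
`C(ρ(E∖I), δ)` — and the high right-hand pairs — `lo + δ ≤ ρ(E∖J) ≤ hi + δ`, `ρ(J) ≥ hi + 1`, weight `C(ρ(E∖J), δ)`.  It is STRONGER
than `(PLD)[lo, hi, δ; Θ]` (which adds the low sources to both sides: `PavingPLD.pld_of_card_residual_le`), it holds on every matroid
with ≤ 9 elements and on the direct sums of those with `U_{1,2}, U_{2,3}, U_{2,4}, U_{2,5}, U_{3,5}, U_{4,7}` (kit j336636: 385,370
matroids, 0 failures), and it is what the cell's injections `RS → THI` prove (paving: `PavingPLD.card_residual_le_card_high`).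
THE POINT (g36): the symmetric-coordinate certificate LP of the lift tower, fed with the RESIDUAL instances of `M` instead of the
(PLD) instances, has NO CEILING in the range probed — `(PLD_hi)(M) ⟹ (PLD)(M ⊕ U_{2,3})` is certifiable at every rank ≤ 20 where
the (PLD) tower stops at rank 6 (kit j336619) — so the residual certificate lemma below is the transfer principle of a second tower.
* `sum_le_of_cert_res` — the certificate lemma: a list of residual instances `(lo, hi, δ, N)` whose symmetrised pointwise
  combination dominates a target `gL ≤ gR` on `[0, R]²` proves `Σ gL ≤ Σ gR` on every matroid of rank ≤ R satisfying the
  residual inequalities (`hRES`, in the SUM form of the bridge's binder);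
* `res_sum_of_card` — the sum form of the residual inequalities from the `Finset.sigma` form with a basis selector `K`
  (`PavingPLD.pld_of_card_residual_le_all`'s hypothesis `hres`);
* `res_of_paving` — every finite paving matroid satisfies the residual inequalities (`card_residual_le_card_high`).
No `def`, no `instance`, no notation.  Axioms: standard.
-/

open scoped Matroid

namespace PercRepro

open Finset ThmH

namespace PLDResCert

variable {α : Type} [DecidableEq α]

/-- THE RESIDUAL CERTIFICATE LEMMA.  `L` lists residual instances `(lo, hi, δ, N)`; `hcert` the pointwise symmetrised
certificate on `[0, R]²`; `hRES` the residual inequalities of `M` in sum form. -/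
theorem sum_le_of_cert_res (M : Matroid α) [M.Finite]
    (hRES : ∀ lo hi δ : ℕ,
      (∑ I ∈ (gr M).powerset, (if lo ≤ (M.eRk (I : Set α)).toNat ∧ (M.eRk (I : Set α)).toNat ≤ hi ∧
          hi + δ + 1 ≤ (M.eRk ((gr M \ I : Finset α) : Set α)).toNat then
          ((M.eRk ((gr M \ I : Finset α) : Set α)).toNat).choose δ else 0)) ≤
        ∑ I ∈ (gr M).powerset, (if lo + δ ≤ (M.eRk ((gr M \ I : Finset α) : Set α)).toNat ∧
          (M.eRk ((gr M \ I : Finset α) : Set α)).toNat ≤ hi + δ ∧ hi + 1 ≤ (M.eRk (I : Set α)).toNat then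
          ((M.eRk ((gr M \ I : Finset α) : Set α)).toNat).choose δ else 0))
    (R : ℕ) (hR : M.eRank ≤ R) (L : List (ℕ × ℕ × ℕ × ℕ))
    (gL gR : ℕ → ℕ → ℕ)
    (hcert : ∀ x ∈ range (R + 1), ∀ f ∈ range (R + 1),
      gL x f + gL f x + (L.map (fun k : ℕ × ℕ × ℕ × ℕ => k.2.2.2 *
        ((if k.1 + k.2.2.1 ≤ f ∧ f ≤ k.2.1 + k.2.2.1 ∧ k.2.1 + 1 ≤ x then f.choose k.2.2.1 else 0) +
          (if k.1 + k.2.2.1 ≤ x ∧ x ≤ k.2.1 + k.2.2.1 ∧ k.2.1 + 1 ≤ f then x.choose k.2.2.1 else 0)))).sum ≤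
      gR x f + gR f x + (L.map (fun k : ℕ × ℕ × ℕ × ℕ => k.2.2.2 *
        ((if k.1 ≤ x ∧ x ≤ k.2.1 ∧ k.2.1 + k.2.2.1 + 1 ≤ f then f.choose k.2.2.1 else 0) +
          (if k.1 ≤ f ∧ f ≤ k.2.1 ∧ k.2.1 + k.2.2.1 + 1 ≤ x then x.choose k.2.2.1 else 0)))).sum) :
    ∑ I ∈ (gr M).powerset, gL (M.eRk (I : Set α)).toNat (M.eRk ((gr M \ I : Finset α) : Set α)).toNat ≤
      ∑ I ∈ (gr M).powerset, gR (M.eRk (I : Set α)).toNat (M.eRk ((gr M \ I : Finset α) : Set α)).toNat := by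
  induction L generalizing gL gR with
  | nil =>
    simp only [List.map_nil, List.sum_nil, add_zero] at hcert
    have hsum := Finset.sum_le_sum (s := (gr M).powerset) fun I _ =>
      hcert (M.eRk (I : Set α)).toNat (mem_range.2 (Nat.lt_succ_of_le (PLDCert.toNat_eRk_le_of_eRank_le M hR _)))
        (M.eRk ((gr M \ I : Finset α) : Set α)).toNat
        (mem_range.2 (Nat.lt_succ_of_le (PLDCert.toNat_eRk_le_of_eRank_le M hR _)))
    rw [Finset.sum_add_distrib, Finset.sum_add_distrib, ← PLDClosure.sum_complement M gL,
      ← PLDClosure.sum_complement M gR] at hsum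
    omega
  | cons k L ih =>
    simp only [List.map_cons, List.sum_cons] at hcert
    have key := ih
      (fun x f => gL x f + k.2.2.2 * (if k.1 + k.2.2.1 ≤ f ∧ f ≤ k.2.1 + k.2.2.1 ∧ k.2.1 + 1 ≤ x then
        f.choose k.2.2.1 else 0))
      (fun x f => gR x f + k.2.2.2 * (if k.1 ≤ x ∧ x ≤ k.2.1 ∧ k.2.1 + k.2.2.1 + 1 ≤ f then
        f.choose k.2.2.1 else 0))
      (fun x hx f hf => by
        have h := hcert x hx f hf
        linarith)
    beta_reduce at key
    rw [Finset.sum_add_distrib, Finset.sum_add_distrib, ← Finset.mul_sum, ← Finset.mul_sum] at key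
    have hk := hRES k.1 k.2.1 k.2.2.1
    have hk' := Nat.mul_le_mul_left k.2.2.2 hk
    linarith

/-- THE SUM FORM OF THE RESIDUAL INEQUALITIES from the `Finset.sigma` form with a basis selector `K`
(the hypothesis `hres` of `PavingPLD.pld_of_card_residual_le_all`). -/
theorem res_sum_of_card (M : Matroid α) [M.Finite] (K : Finset α → Finset α)
    (hK : ∀ X, K X ⊆ X ∧ M.Indep (K X : Set α) ∧ (K X).card = (M.eRk (X : Set α)).toNat)
    (hres : ∀ lo hi δ : ℕ,
      (((gr M).powerset.filter (fun I : Finset α => lo ≤ (M.eRk (I : Set α)).toNat ∧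
        (M.eRk (I : Set α)).toNat ≤ hi ∧ hi + δ + 1 ≤ (M.eRk ((gr M \ I : Finset α) : Set α)).toNat)).sigma
      (fun I : Finset α => powersetCard δ (K (gr M \ I)))).card ≤
      (((gr M).powerset.filter (fun J : Finset α => lo + δ ≤ (M.eRk ((gr M \ J : Finset α) : Set α)).toNat ∧
        (M.eRk ((gr M \ J : Finset α) : Set α)).toNat ≤ hi + δ ∧ hi + 1 ≤ (M.eRk (J : Set α)).toNat)).sigma
      (fun J : Finset α => powersetCard δ (K (gr M \ J)))).card) :
    ∀ lo hi δ : ℕ,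
      (∑ I ∈ (gr M).powerset, (if lo ≤ (M.eRk (I : Set α)).toNat ∧ (M.eRk (I : Set α)).toNat ≤ hi ∧
          hi + δ + 1 ≤ (M.eRk ((gr M \ I : Finset α) : Set α)).toNat then
          ((M.eRk ((gr M \ I : Finset α) : Set α)).toNat).choose δ else 0)) ≤
        ∑ I ∈ (gr M).powerset, (if lo + δ ≤ (M.eRk ((gr M \ I : Finset α) : Set α)).toNat ∧
          (M.eRk ((gr M \ I : Finset α) : Set α)).toNat ≤ hi + δ ∧ hi + 1 ≤ (M.eRk (I : Set α)).toNat then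
          ((M.eRk ((gr M \ I : Finset α) : Set α)).toNat).choose δ else 0) := by
  intro lo hi δ
  rw [← sum_filter, ← sum_filter]
  have e1 : ∀ s : Finset (Finset α), ∑ I ∈ s, ((M.eRk ((gr M \ I : Finset α) : Set α)).toNat).choose δ =
      (s.sigma (fun I : Finset α => powersetCard δ (K (gr M \ I)))).card := by
    intro s
    rw [card_sigma]
    apply sum_congr rfl
    intro I _
    rw [card_powersetCard, (hK _).2.2]
  rw [e1, e1]
  exact hres lo hi δ

/-- EVERY FINITE PAVING MATROID SATISFIES THE RESIDUAL INEQUALITIES (the injection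
`PavingPLD.card_residual_le_card_high` in sum form). -/
theorem res_of_paving (M : Matroid α) [M.Finite] (hpav : ∀ C, M.IsCircuit C → M.eRank ≤ C.encard) :
    ∀ lo hi δ : ℕ,
      (∑ I ∈ (gr M).powerset, (if lo ≤ (M.eRk (I : Set α)).toNat ∧ (M.eRk (I : Set α)).toNat ≤ hi ∧
          hi + δ + 1 ≤ (M.eRk ((gr M \ I : Finset α) : Set α)).toNat then
          ((M.eRk ((gr M \ I : Finset α) : Set α)).toNat).choose δ else 0)) ≤
        ∑ I ∈ (gr M).powerset, (if lo + δ ≤ (M.eRk ((gr M \ I : Finset α) : Set α)).toNat ∧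
          (M.eRk ((gr M \ I : Finset α) : Set α)).toNat ≤ hi + δ ∧ hi + 1 ≤ (M.eRk (I : Set α)).toNat then
          ((M.eRk ((gr M \ I : Finset α) : Set α)).toNat).choose δ else 0) := by
  choose K hK using PavingPLD.exists_indep_subset_card_eq M
  exact res_sum_of_card M K hK (fun lo hi δ => PavingPLD.card_residual_le_card_high M hpav K hK lo hi δ)

end PLDResCert

end PercRepro
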